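import Summits.QuantumAdvantage.AdviceFreeQNC0.AffBells27CubeTargetEven
import HarnessLib

/-!
# Sketch27 §27.1–§27.2 (planner qn-p1 g27, ROUND-26 §2–§4): the light witness for move cubes, WINDOWED certificates per strategy,
# the windowed density upgrade  and the linear-loss rung — statements (+ the planner's PROVED corollaries)

(VERBATIM copy of lines 411–592 of `HOME/qa-qnc0-p1/exp27/Sketch27.lean` (sha16 `7554022ab31b35b7`; its lines 1–410 are the landed
`AffBells26FlipCubeSieve` + `AffBells26MoveSystems`), authored by the planner seat qn-p1 g27; landed by the prover seat qn-prover-3 g14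
(ask P-27c, port half).  The only changes: this paragraph; the `def CubeTargetEven` of §27.1 is NOT re-declared — it is the landed
`AffBells27lit.CubeTargetEven` (same text; PROVED as `AffBells27lit.cubeTargetEven`, file `AffBells27CubeTargetEven.lean`), found here
through `open AffBells27lit`; one docstring added (`not_mismatch_zero`); and the unconditional corollaries `not_s26LocalLog'`,
`not_s26LocalBounded'` at the end (discharging `hT` by `cubeTargetEven`).)

Contents.  §27.1: `dF_zero`, `survF_zero`, `survSumF_zero`, `not_cubeRefutableGen_zero`, **`not_cubeRefutableGenAll`**,
`not_mismatch_zero`, `not_localCertificate_zero`, `not_s26LocalLog`, `not_s26LocalBounded` (all PROVED: the light witness `β = 0`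
kills every universally quantified refutability statement of Sketch26).  §27.2: `win4`, `Oof`, `SubFibre`, `ClassRefutes`,
`ClassRefutesAll`, `windowCands`, `refFrac`, `WindowRefutable`, **`DensityUpgradeWin`** (prover target P-27c), `AffBellsLinLoss3`,
and the PROVED `affWin_le_of_windowRefutable`, `polyLoss_of_linLoss`.
WHAT THIS IS NOT: `DensityUpgradeWin` is NOT proved here; §27.3–§27.4 (frame dichotomy; the frame side is the landed
`AffBells27FrameGlue`) are not ported here; separation NOT moved.
-/

namespace Summit.QuantumAdvantage.AdviceFreeQNC0

namespace AffBells26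

open Finset Literature.Computability.QuantumComplexity Literature.Computability.QuantumComplexity.RingHLF
open AffBells23 Fib19 AffBells27lit

/-! ## §27 (qn-p1 g27, ROUND-26) — the LIGHT WITNESS, windowed certificates per strategy, and the corrected (NP₁) programme

### §27.1 The light witness `β = 0` kills every universally quantified refutability statement above
A row survives a cube only if it SEES every move not owning it; the zero matrix sees nothing, so `Surv = SurvF = ∅`, every
survivors' sum vanishes, and `CubeRefutable 0`, `CubeRefutableGen 0` fail at every `N`.  Hence `CubeRefutableAll` and
`CubeRefutableGenAll` are FALSE (so `noPerfectAffineBells3_of_S26` / `_of_S26gen` have unsatisfiable hypotheses), and — given the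
hypothesis-free evenness of the cube target sum along move systems (`CubeTargetEven`; exp27 check: 0 odd in 300 valid systems) — so are
`S26LocalBounded Z₀ m₀` and `S26LocalLog κ` for all parameters.  The same witness is any `β` whose rows all have weight ≤ 1 (a row reading one
bit cannot see two disjoint moves).  The tree-facing file `exp27/AffBells27LightWitness.lean` proves `¬ CubeRefutableAll` against the landed
definition.  MORAL: every sieve theorem needs a HEAVINESS hypothesis on `β` (`CubeRefutableDense` is correctly guarded), and LIGHT strategies need
their own argument (R0 = `RingFixedBellsSharp3` for weight 0). -/

/-- For the zero matrix every move drift vanishes. -/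
theorem dF_zero {N m : ℕ} (x : Fin N → Bool) (F : Fin m → Finset (Fin N)) (g : Fin N) (j : Fin m) :
    dF (0 : Fin N → Fin N → ZMod 3) x F g j = 0 := by
  simp [dF]

/-- For the zero matrix no row survives a move cube with `m ≥ 2`. -/
theorem survF_zero {N m : ℕ} (x : Fin N → Bool) (F O : Fin m → Finset (Fin N)) (hMS : MoveSystem x F O) (hm : 2 ≤ m) :
    SurvF (0 : Fin N → Fin N → ZMod 3) x F O = ∅ := by
  unfold SurvF
  refine Finset.filter_eq_empty_iff.mpr ?_
  intro g _ hg
  have hne : (⟨0, by omega⟩ : Fin m) ≠ ⟨1, by omega⟩ := by simp [Fin.ext_iff]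
  have hdisj := (hMS.2.2.1 ⟨0, by omega⟩ ⟨1, by omega⟩ hne).2
  by_cases h0 : g ∈ O ⟨0, by omega⟩
  · by_cases h1 : g ∈ O ⟨1, by omega⟩
    · exact absurd h1 (Finset.disjoint_left.mp hdisj h0)
    · exact hg.2 _ h1 (dF_zero x F g _)
  · exact hg.2 _ h0 (dF_zero x F g _)

/-- For the zero matrix the move-cube survivors' sum vanishes. -/
theorem survSumF_zero {N m : ℕ} (c : Fin N → ZMod 3) (x : Fin N → Bool) (F O : Fin m → Finset (Fin N))
    (hMS : MoveSystem x F O) (hm : 2 ≤ m) : survSumF (0 : Fin N → Fin N → ZMod 3) c x F O = 0 := by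
  unfold survSumF
  rw [survF_zero x F O hMS hm]
  simp

/-- The zero matrix is not move-cube-refutable. -/
theorem not_cubeRefutableGen_zero (N : ℕ) : ¬ CubeRefutableGen (0 : Fin N → Fin N → ZMod 3) := by
  intro h
  obtain ⟨m, x, F, O, hm, hMS, _, hodd⟩ := h 0
  rw [survSumF_zero 0 x F O hMS hm] at hodd
  omega

/-- **`CubeRefutableGenAll` is false** (witness `β = 0`). -/
theorem not_cubeRefutableGenAll : ¬ CubeRefutableGenAll := by
  rintro ⟨N₀, h⟩
  exact not_cubeRefutableGen_zero N₀ (h N₀ le_rfl 0)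

/- `CubeTargetEven` (Sketch27 §27.1, verbatim) is the landed `AffBells27lit.CubeTargetEven` (AffBells27CubeTargetEven.lean, p649198, PROVED there:
`AffBells27lit.cubeTargetEven`); it is not re-declared here. -/

/-- Given target evenness, no move cube mismatches for the zero matrix. -/
theorem not_mismatch_zero (hT : CubeTargetEven) {N m : ℕ} (hm : 2 ≤ m) (c : Fin N → ZMod 3) (x : Fin N → Bool)
    (F O : Fin m → Finset (Fin N)) (hMS : MoveSystem x F O) : ¬ Mismatch (0 : Fin N → Fin N → ZMod 3) c x F O := by
  unfold Mismatch
  rw [survSumF_zero c x F O hMS hm, hT N m hm x F O hMS]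
  omega

/-- Given target evenness, the zero matrix has no local certificate with `m ≥ 2` on a realisable zone pattern. -/
theorem not_localCertificate_zero (hT : CubeTargetEven) {N m : ℕ} (hm : 2 ≤ m) (C : Finset (Fin N))
    (F O : Fin m → Finset (Fin N)) (hreal : ∃ x : Fin N → Bool, IsOdd x ∧ klineZeros x ∩ near2 (footprint C F O) = C) :
    ¬ LocalCertificate (0 : Fin N → Fin N → ZMod 3) C F O := by
  intro hLC
  obtain ⟨x, hx, hzone⟩ := hreal
  obtain ⟨x', _, _, _, hMS, hMis⟩ := hLC 0 x hx hzone
  exact not_mismatch_zero hT hm 0 x' F O hMS hMis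

/-- **`S26LocalLog κ` is false for every `κ`** (given target evenness; witness `β = 0`). -/
theorem not_s26LocalLog (hT : CubeTargetEven) (κ : ℕ) : ¬ S26LocalLog κ := by
  rintro ⟨N₀, h⟩
  obtain ⟨C, m, F, O, hm, _, _, hreal, hLC⟩ := h N₀ le_rfl 0
  exact not_localCertificate_zero hT hm C F O hreal hLC

/-- **`S26LocalBounded Z₀ m₀` is false for all parameters** (same witness). -/
theorem not_s26LocalBounded (hT : CubeTargetEven) (Z₀ m₀ : ℕ) : ¬ S26LocalBounded Z₀ m₀ := by
  rintro ⟨N₀, h⟩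
  obtain ⟨C, m, F, O, hm, _, _, _, hreal, hLC⟩ := h N₀ le_rfl 0
  exact not_localCertificate_zero hT hm C F O hreal hLC

/-! ### §27.2 WINDOWED certificates PER STRATEGY and the `e = 1` double count

exp26d/sieve6, exp27/sieve7 certify at a random odd input `x`, a random `Z`-subset `C₀` of its coins and a random triple of move windows that the
SUB-FIBRE class refutes `β` for EVERY `c` (meet-in-the-middle).  exp27/sieve7 (kit j311105) shows this c-FREE form FAILS at random windows for
structured matrices (twin4, frame ⊗ junta, coherent + noise: a majority of windows solvable by SOME local offsets), while exp27/sieve8 (kit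
j311208) shows that for every such matrix NO SINGLE offset vector solves more than ≈ 0.4 of the windows (annealing over `c ∈ 𝔽₃^N`).
So the statement the double count consumes is c-SPECIFIC and PER STRATEGY: `WindowRefutable δ Z β c`.  It is NOT universal: the light
witness `β = 0` refutes no window at all (§27.1), and rows of coin-weight ≪ N/Z are invisible to `Z`-windows.  The count is weighted by
`1/|windowCands x Z|`, which makes the fibre over a lost input telescope to `≤ 8·2^Z`: losses ≥ δ 2^{N-1}/2^{Z+3}. -/

/-- Move windows: unordered pairs of ring positions at cyclic distance `1 … 4` (flip sets of creations, hops, annihilations). -/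
def win4 (N : ℕ) : Finset (Finset (Fin N)) :=
  univ.filter fun F => ∃ a : Fin N,
    F = {a, nxt a} ∨ F = {a, nxt (nxt a)} ∨ F = {a, nxt (nxt (nxt a))} ∨ F = {a, nxt (nxt (nxt (nxt a)))}

/-- Owned sets DERIVED from the flip sets: the rows whose activity the single move `j` toggles at `x`. -/
def Oof {N m : ℕ} (x : Fin N → Bool) (F : Fin m → Finset (Fin N)) (j : Fin m) : Finset (Fin N) :=
  univ.filter fun i => kline (flipAt x (F j)) i ≠ kline x i

/-- The SUB-FIBRE of `x` along `C₀`: odd inputs with the same kernel line that agree with `x` off `C₀` (at most `2^{|C₀|}` points). -/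
def SubFibre {N : ℕ} (x : Fin N → Bool) (C₀ : Finset (Fin N)) : Finset (Fin N → Bool) :=
  univ.filter fun x' => IsOdd x' ∧ kline x' = kline x ∧ ∀ i, i ∉ C₀ → x' i = x i

open scoped Classical in
/-- The window class `(x, C₀, F)` REFUTES `(β, c)`: at some point of the sub-fibre the flip sets (with their derived owned sets) form a move
system and the cube MISMATCHES — so, by `CubeIdentityGen` + `TargetFormula`, one of the `2^m` cube points over that point is lost. -/
def ClassRefutes {N m : ℕ} (β : Fin N → Fin N → ZMod 3) (c : Fin N → ZMod 3) (x : Fin N → Bool) (C₀ : Finset (Fin N))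
    (F : Fin m → Finset (Fin N)) : Prop :=
  ∃ x' ∈ SubFibre x C₀, MoveSystem x' F (Oof x' F) ∧ Mismatch β c x' F (Oof x' F)

/-- The `c`-FREE form (what the sieve scripts certify). -/
def ClassRefutesAll {N m : ℕ} (β : Fin N → Fin N → ZMod 3) (x : Fin N → Bool) (C₀ : Finset (Fin N))
    (F : Fin m → Finset (Fin N)) : Prop :=
  ∀ c : Fin N → ZMod 3, ClassRefutes β c x C₀ F

/-- Window candidates at `x`: a `Z`-subset of the coins and three windows (overlapping triples are allowed and never refute). -/
def windowCands {N : ℕ} (x : Fin N → Bool) (Z : ℕ) : Finset (Finset (Fin N) × (Fin 3 → Finset (Fin N))) :=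
  ((klineZeros x).powersetCard Z) ×ˢ (univ.filter fun F : Fin 3 → Finset (Fin N) => ∀ j, F j ∈ win4 N)

open scoped Classical in
/-- Refuting FRACTION of the window candidates at `x` (0 if there are none). -/
noncomputable def refFrac {N : ℕ} (β : Fin N → Fin N → ZMod 3) (c : Fin N → ZMod 3) (Z : ℕ) (x : Fin N → Bool) : ℝ :=
  (((windowCands x Z).filter fun p => ClassRefutes β c x p.1 p.2).card : ℝ) / ((windowCands x Z).card : ℝ)

/-- `(β, c)` is `(δ, Z)`-WINDOW-REFUTABLE: the refuting fraction, summed over the odd class, is at least `δ·2^{N-1}`. -/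
def WindowRefutable {N : ℕ} (δ : ℝ) (Z : ℕ) (β : Fin N → Fin N → ZMod 3) (c : Fin N → ZMod 3) : Prop :=
  δ * (2 : ℝ) ^ (N - 1) ≤ ∑ x ∈ univ.filter (fun x : Fin N → Bool => IsOdd x), refFrac β c Z x

/-- **THE WINDOWED DENSITY UPGRADE, per strategy (statement; prover target P-27c).**  Telescoping double count: map each refuting triple
`(x, C₀, F)` (weight `1/|windowCands x Z|`) to a lost cube point `ℓ = xF x'' F S` over its mismatch point `x''`; given `ℓ`, the triples over it
are `(F, S) ↦ x''`, `C₀ ⊆ klineZeros x'' = klineZeros x`, `x ∈ SubFibre x'' C₀` (≤ `2^Z` points), so `ℓ` receives weight ≤ `8·2^Z` and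
`#losses ≥ δ 2^{N-1} / 2^{Z+3}`. -/
def DensityUpgradeWin : Prop :=
  CubeIdentityGen → TargetFormula → ∀ N : ℕ, 5 ≤ N → ∀ (Z : ℕ) (δ : ℝ) (β : Fin N → Fin N → ZMod 3) (c : Fin N → ZMod 3),
    0 < δ → WindowRefutable δ Z β c → δ * (2 : ℝ) ^ (N - 1) / (2 : ℝ) ^ (Z + 3) ≤ (2 : ℝ) ^ (N - 1) - (affWinCard β c : ℝ)

/-- **(NP₁) with `e = 1`: LINEAR loss density for affine MOD₃ bells.** -/
def AffBellsLinLoss3 : Prop :=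
  ∃ κ : ℝ, 0 < κ ∧ ∃ n₀ : ℕ, ∀ N ≥ n₀, ∀ (β : Fin N → Fin N → ZMod 3) (c : Fin N → ZMod 3),
    (affWinCard β c : ℝ) ≤ (1 - κ / (N : ℝ)) * (2 : ℝ) ^ (N - 1)

/-- With `Z = log₂ N + K` a window-refutable strategy loses a `δ/2^{K+3}/N` fraction (PROVED from the upgrade statement). -/
theorem affWin_le_of_windowRefutable (hU : DensityUpgradeWin) (h0 : CubeIdentityGen) (h1 : TargetFormula) {N : ℕ} (hN : 5 ≤ N)
    (K : ℕ) {δ : ℝ} (hδ : 0 < δ) (β : Fin N → Fin N → ZMod 3) (c : Fin N → ZMod 3)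
    (hW : WindowRefutable δ (Nat.log 2 N + K) β c) :
    (affWinCard β c : ℝ) ≤ (1 - δ / (2 : ℝ) ^ (K + 3) / (N : ℝ)) * (2 : ℝ) ^ (N - 1) := by
  have h := hU h0 h1 N hN (Nat.log 2 N + K) δ β c hδ hW
  have hNpos : (0 : ℝ) < N := by exact_mod_cast (show 0 < N by omega)
  have hlog : ((2 : ℕ) ^ Nat.log 2 N : ℝ) ≤ (N : ℝ) := by exact_mod_cast Nat.pow_log_le_self 2 (by omega : N ≠ 0)
  have hpowZ : (2 : ℝ) ^ (Nat.log 2 N + K + 3) ≤ (2 : ℝ) ^ (K + 3) * (N : ℝ) := by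
    rw [show Nat.log 2 N + K + 3 = (K + 3) + Nat.log 2 N by omega, pow_add]
    have : (2 : ℝ) ^ Nat.log 2 N ≤ (N : ℝ) := by exact_mod_cast hlog
    exact mul_le_mul_of_nonneg_left this (by positivity)
  have hpos1 : (0 : ℝ) < (2 : ℝ) ^ (Nat.log 2 N + K + 3) := by positivity
  have hmono : δ * (2 : ℝ) ^ (N - 1) / ((2 : ℝ) ^ (K + 3) * (N : ℝ)) ≤ δ * (2 : ℝ) ^ (N - 1) / (2 : ℝ) ^ (Nat.log 2 N + K + 3) :=
    div_le_div_of_nonneg_left (by positivity) hpos1 hpowZ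
  have key : δ * (2 : ℝ) ^ (N - 1) / ((2 : ℝ) ^ (K + 3) * (N : ℝ)) ≤ (2 : ℝ) ^ (N - 1) - (affWinCard β c : ℝ) := hmono.trans h
  have hrw : (1 - δ / (2 : ℝ) ^ (K + 3) / (N : ℝ)) * (2 : ℝ) ^ (N - 1)
      = (2 : ℝ) ^ (N - 1) - δ * (2 : ℝ) ^ (N - 1) / ((2 : ℝ) ^ (K + 3) * (N : ℝ)) := by
    field_simp
  rw [hrw]
  linarith

/-- Linear loss is inverse-polynomial loss (`e = 2`, `n₀ ≥ 1/κ`). -/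
theorem polyLoss_of_linLoss (h : AffBellsLinLoss3) : AffBellsPolyLoss3 := by
  obtain ⟨κ, hκ, n₀, hn⟩ := h
  obtain ⟨M, hM⟩ := exists_nat_gt (1 / κ)
  refine ⟨2, max n₀ (max M 1), fun N hN β c => ?_⟩
  have hN0 : n₀ ≤ N := le_of_max_le_left hN
  have hNM : (M : ℝ) ≤ N := by exact_mod_cast le_of_max_le_left (le_of_max_le_right hN)
  have hN1 : (1 : ℝ) ≤ N := by exact_mod_cast le_of_max_le_right (le_of_max_le_right hN)
  have hNpos : (0 : ℝ) < N := by linarith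
  refine (hn N hN0 β c).trans ?_
  have hpow : (0 : ℝ) < (2 : ℝ) ^ (N - 1) := by positivity
  have hkey : 1 / (N : ℝ) ^ 2 ≤ κ / (N : ℝ) := by
    rw [div_le_div_iff₀ (by positivity) hNpos]
    have h1 : 1 / κ < N := lt_of_lt_of_le hM hNM
    have h2 : 1 < κ * N := by
      have := (div_lt_iff₀ hκ).mp h1
      linarith [this]
    nlinarith [h2, hNpos]
  have : (1 - κ / (N : ℝ)) ≤ (1 - 1 / (N : ℝ) ^ 2) := by linarith
  exact mul_le_mul_of_nonneg_right this hpow.le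

/-- **`S26LocalLog κ` is false for every `κ`**, unconditionally (`AffBells27lit.cubeTargetEven`). -/
theorem not_s26LocalLog' (κ : ℕ) : ¬ S26LocalLog κ := not_s26LocalLog cubeTargetEven κ

/-- **`S26LocalBounded Z₀ m₀` is false for all parameters**, unconditionally. -/
theorem not_s26LocalBounded' (Z₀ m₀ : ℕ) : ¬ S26LocalBounded Z₀ m₀ := not_s26LocalBounded cubeTargetEven Z₀ m₀

end AffBells26

end Summit.QuantumAdvantage.AdviceFreeQNC0
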